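import Mathlib
import Summits.Ventures.PercRepro2.Defs
import Summits.Ventures.PercRepro2.Harris
import Summits.Ventures.PercRepro2.Graph
import Summits.Ventures.PercRepro2.Events
import Summits.Ventures.PercRepro2.Induced
import Summits.Ventures.PercRepro2.BHK
import Summits.Ventures.PercRepro2.BHKEvents
import Summits.Ventures.PercRepro2.BHKAvoid
import Summits.Ventures.PercRepro2.VdBKahn
import Summits.Ventures.PercRepro2.CCTRootEdge
import Summits.Ventures.PercRepro2.CCTAvoidedEdge
import Summits.Ventures.PercRepro2.OneRootDropMono
import Summits.Ventures.PercRepro2.AvoidMono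

/-!
# The avoided-set ANTI-monotonicity: an edge at an avoided vertex lowers the reach of the avoiding
cluster (blind cell PercRepro2, mine-a g34; MINE-A.md §89.7, proofs/MINEA-CD-NESTED.md §2 (B))

The mirror of mine-c g30's `AvoidMono.avoid_mono`.  A root `a₂`, a finite set `S` of vertices with
`v ∈ S`, an edge `e = {v, y}` of weight `t`, and a mark `o`.  The conditional probability

  `P_t(o ∈ C(a₂) ∣ a₂ ↮ S)`

is NON-INCREASING in `t` (`avoid_anti`): with `e` open, `a₂ ↮ S` holds iff (with `e` closed) `a₂ ↮ S`
and `a₂ ↮ y`, and the cluster of `a₂` is then the same in both worlds (`CCT.cluster_update_true_eq_of_not_touch`);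
by BHK06 Thm 1.1 with the avoided set `S` (`bhk_induced`, `X = Y = S`: the cluster of `a₂` is
positively associated given it avoids `S` — `bhk_same_cluster_avoid`), the extra decreasing condition
`{y ∉ C(a₂)}` lowers the up-set `{o ∈ C(a₂)}` (`bhk13_avoid_complement`); the conditional
probability at `t` is the mediant of the `e`-closed and `e`-open values with the weight on the
second growing with `t`.  Together with `avoid_mono` (which raises every up-set of `C(a₁)`), this is
the cross-world monotonicity of the nested-routes theorem.  No definition; one seat.
-/

namespace Summit.Ventures.PercRepro2

namespace CDAvoidAnti

variable {V : Type*} {E : Type*} [Fintype V] [DecidableEq V] [Fintype E] [DecidableEq E]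
  {R : Type*} [Field R] [LinearOrder R] [IsStrictOrderedRing R]

section BHK

variable (p : E → R) (ends : E → Sym2 V)

/-- **BHK, same cluster, with set avoidance** (BHK06 Thm 1.1 with `X = Y = S`): for up-sets `𝓤, 𝓥`,
`P(C_s ∈ 𝓤, s ↮ S) · P(C_s ∈ 𝓥, s ↮ S) ≤ P(C_s ∈ 𝓤, C_s ∈ 𝓥, s ↮ S) · P(s ↮ S)`. -/
theorem bhk_same_cluster_avoid (hp : IsProbVec p) (s : V) (S : Finset V) {𝓤 𝓥 : Set (Set V)}
    (h𝓤 : IsUpperSet 𝓤) (h𝓥 : IsUpperSet 𝓥) :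
    prob p (clusterInEvent ends s 𝓤 ∩ avoidAll ends s S) *
        prob p (clusterInEvent ends s 𝓥 ∩ avoidAll ends s S) ≤
      prob p (clusterInEvent ends s 𝓤 ∩ clusterInEvent ends s 𝓥 ∩ avoidAll ends s S) *
        prob p (avoidAll ends s S) := by
  have key := bhk_induced p hp ends s (monotone_indicator_one_of_isUpperSet (R := R) h𝓤)
    (monotone_indicator_one_of_isUpperSet (R := R) h𝓥)
    (fun _ => Set.indicator_apply_nonneg fun _ => zero_le_one)
    (fun _ => Set.indicator_apply_nonneg fun _ => zero_le_one) Finset.univ S S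
    (Finset.subset_univ _) (Finset.subset_univ _)
  simp only [Finset.inter_self, Finset.union_self, REvent_univ] at key
  have e : ∀ F : Set V → R, clusterObs ends Finset.univ s F * (avoidAll ends s S).indicator 1 =
      fun ω => F (cluster ends ω s) * (avoidAll ends s S).indicator 1 ω := by
    intro F
    funext ω
    simp only [Pi.mul_apply, clusterObs_apply, clusterIn_univ]
  rw [e, e, e] at key
  rw [← prob_clusterInEvent_inter_eq_expect, ← prob_clusterInEvent_inter_eq_expect] at key
  have e' : (fun ω => ((𝓤.indicator (1 : Set V → R)) * (𝓥.indicator (1 : Set V → R)))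
        (cluster ends ω s) * (avoidAll ends s S).indicator 1 ω) =
      fun ω => (𝓤 ∩ 𝓥).indicator (1 : Set V → R) (cluster ends ω s) *
        (avoidAll ends s S).indicator 1 ω := by
    funext ω
    simp only [Pi.mul_apply]
    by_cases h1 : cluster ends ω s ∈ 𝓤 <;> by_cases h2 : cluster ends ω s ∈ 𝓥 <;> simp [h1, h2]
  rw [e', ← prob_clusterInEvent_inter_eq_expect] at key
  have e2 : clusterInEvent ends s (𝓤 ∩ 𝓥) = clusterInEvent ends s 𝓤 ∩ clusterInEvent ends s 𝓥 := by
    ext ω; simp [clusterInEvent]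
  rw [e2] at key
  exact key

/-- **BHK06 1.3 with the avoided set `S`, complement form**: for `o, y`,
`P(o ∈ C(a₂), a₂ ↮ S, a₂ ↮ y) · P(a₂ ↮ S) ≤ P(o ∈ C(a₂), a₂ ↮ S) · P(a₂ ↮ S, a₂ ↮ y)`. -/
lemma bhk13_avoid_complement (hp : IsProbVec p) (a₂ o y : V) (S : Finset V) :
    prob p (connEvent ends a₂ o ∩ avoidAll ends a₂ S ∩ avoidAll ends a₂ {y}) *
        prob p (avoidAll ends a₂ S) ≤
      prob p (connEvent ends a₂ o ∩ avoidAll ends a₂ S) *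
        prob p (avoidAll ends a₂ S ∩ avoidAll ends a₂ {y}) := by
  have hUo : IsUpperSet {L : Set V | o ∈ L} := fun _ _ hST h => hST h
  have hUy : IsUpperSet {L : Set V | y ∈ L} := fun _ _ hST h => hST h
  have key := bhk_same_cluster_avoid p ends hp a₂ S hUo hUy
  have eo : clusterInEvent ends a₂ {L : Set V | o ∈ L} = connEvent ends a₂ o := by
    ext ω; simp only [mem_clusterInEvent, Set.mem_setOf_eq, mem_cluster, mem_connEvent]
  have ey : clusterInEvent ends a₂ {L : Set V | y ∈ L} = connEvent ends a₂ y := by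
    ext ω; simp only [mem_clusterInEvent, Set.mem_setOf_eq, mem_cluster, mem_connEvent]
  rw [eo, ey] at key
  rw [AvoidMono.avoid_singleton_eq_compl]
  set Ω := avoidAll ends a₂ S with hΩ
  set F := connEvent ends a₂ o with hF
  set Y := connEvent ends a₂ y with hY
  -- `key : P(F ∩ Ω) · P(Y ∩ Ω) ≤ P(F ∩ Y ∩ Ω) · P(Ω)`
  have s1 := prob_inter_add_prob_inter_compl p (F ∩ Ω) Y
  have s2 := prob_inter_add_prob_inter_compl p Ω Y
  have k1 : F ∩ Y ∩ Ω = F ∩ Ω ∩ Y := by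
    ext ω; simp only [Set.mem_inter_iff]; tauto
  have k2 : Y ∩ Ω = Ω ∩ Y := Set.inter_comm _ _
  rw [k1, k2] at key
  nlinarith [key, s1, s2, prob_nonneg hp (F ∩ Ω), prob_nonneg hp Ω, prob_nonneg hp (F ∩ Ω ∩ Y),
    prob_nonneg hp (Ω ∩ Y), prob_nonneg hp (F ∩ Ω ∩ Yᶜ), prob_nonneg hp (Ω ∩ Yᶜ)]

end BHK

section Pinned

variable (p : E → R) {ends : E → Sym2 V} {e : E} {v y : V}

omit [Fintype V] [DecidableEq V] [LinearOrder R] [IsStrictOrderedRing R] in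
/-- `P₁(o ∈ C(a₂), a₂ ↮ S) = P₀(o ∈ C(a₂), a₂ ↮ S, a₂ ↮ y)` for `v ∈ S`: with `e` open the
avoidance forces `a₂ ↮ y` as well, and then the cluster of `a₂` is the same in both worlds. -/
lemma prob_one_conn_avoidAll (hends : ends e = s(v, y)) (a₂ o : V) {S : Finset V} (hv : v ∈ S) :
    prob (Function.update p e 1) (connEvent ends a₂ o ∩ avoidAll ends a₂ S) =
      prob (Function.update p e 0)
        (connEvent ends a₂ o ∩ avoidAll ends a₂ S ∩ avoidAll ends a₂ {y}) := by
  rw [CCT.prob_update_one_eq, CCT.prob_update_zero_eq]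
  congr 1
  ext ω
  simp only [Set.mem_setOf_eq, Set.mem_inter_iff]
  have hiff := AvoidMono.update_true_mem_avoidAll_iff hends ω a₂ hv
  constructor
  · rintro ⟨hc, hS⟩
    obtain ⟨hS', hy'⟩ := hiff.1 hS
    refine ⟨⟨?_, hS'⟩, hy'⟩
    have hvn : v ∉ cluster ends (Function.update ω e false) a₂ := by
      rw [mem_cluster]; exact hS' v hv
    have hyn : y ∉ cluster ends (Function.update ω e false) a₂ := by
      rw [mem_cluster]; exact hy' y (Finset.mem_singleton_self y)
    have hcl := CCT.cluster_update_true_eq_of_not_touch ends hends ω a₂ hvn hyn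
    rw [mem_connEvent, ← mem_cluster] at hc ⊢
    rw [hcl] at hc
    exact hc
  · rintro ⟨⟨hc, hS'⟩, hy'⟩
    refine ⟨?_, hiff.2 ⟨hS', hy'⟩⟩
    have hvn : v ∉ cluster ends (Function.update ω e false) a₂ := by
      rw [mem_cluster]; exact hS' v hv
    have hyn : y ∉ cluster ends (Function.update ω e false) a₂ := by
      rw [mem_cluster]; exact hy' y (Finset.mem_singleton_self y)
    have hcl := CCT.cluster_update_true_eq_of_not_touch ends hends ω a₂ hvn hyn
    rw [mem_connEvent, ← mem_cluster] at hc ⊢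
    rw [hcl]
    exact hc

/-- **The avoided-set anti-monotonicity theorem**: for `v ∈ S` and an edge `e = {v, y}`,
`P_t(o ∈ C(a₂) ∣ a₂ ↮ S)` is non-increasing in the weight `t` of `e` (for `s ≤ t`, wherever both
conditioning probabilities are positive). -/
theorem avoid_anti (hp : IsProbVec p) (hends : ends e = s(v, y)) (a₂ o : V) {S : Finset V}
    (hv : v ∈ S) {s t : R} (hst : s ≤ t)
    (hs : 0 < prob (Function.update p e s) (avoidAll ends a₂ S))
    (ht : 0 < prob (Function.update p e t) (avoidAll ends a₂ S)) :
    prob (Function.update p e t) (connEvent ends a₂ o ∩ avoidAll ends a₂ S) /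
        prob (Function.update p e t) (avoidAll ends a₂ S) ≤
      prob (Function.update p e s) (connEvent ends a₂ o ∩ avoidAll ends a₂ S) /
        prob (Function.update p e s) (avoidAll ends a₂ S) := by
  have hp₀ : IsProbVec (Function.update p e 0) := hp.update e le_rfl zero_le_one
  have h1 := AvoidMono.prob_one_avoidAll p hends a₂ hv
  have h2 := prob_one_conn_avoidAll p hends a₂ o hv
  have hb := bhk13_avoid_complement (Function.update p e 0) ends hp₀ a₂ o y S
  rw [OneRootDrop.prob_update_eq_pin p s (connEvent ends a₂ o ∩ avoidAll ends a₂ S),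
    OneRootDrop.prob_update_eq_pin p s (avoidAll ends a₂ S),
    OneRootDrop.prob_update_eq_pin p t (connEvent ends a₂ o ∩ avoidAll ends a₂ S),
    OneRootDrop.prob_update_eq_pin p t (avoidAll ends a₂ S), h1, h2]
  rw [OneRootDrop.prob_update_eq_pin p s (avoidAll ends a₂ S), h1] at hs
  rw [OneRootDrop.prob_update_eq_pin p t (avoidAll ends a₂ S), h1] at ht
  rw [div_le_div_iff₀ ht hs]
  generalize hN0' : prob (Function.update p e 0)
    (connEvent ends a₂ o ∩ avoidAll ends a₂ S ∩ avoidAll ends a₂ {y}) = N₁ at *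
  generalize hN0 : prob (Function.update p e 0) (connEvent ends a₂ o ∩ avoidAll ends a₂ S) = N₀
    at *
  generalize hD1 : prob (Function.update p e 0) (avoidAll ends a₂ S ∩ avoidAll ends a₂ {y}) = D₁
    at *
  generalize hD0' : prob (Function.update p e 0) (avoidAll ends a₂ S) = D₀ at *
  -- `hb : N₁ * D₀ ≤ N₀ * D₁`
  have hid : (s * N₁ + (1 - s) * N₀) * (t * D₁ + (1 - t) * D₀) -
      (t * N₁ + (1 - t) * N₀) * (s * D₁ + (1 - s) * D₀) = (t - s) * (N₀ * D₁ - N₁ * D₀) := by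
    ring
  nlinarith [hid, mul_nonneg (sub_nonneg.2 hst) (sub_nonneg.2 hb)]

end Pinned

end CDAvoidAnti

end Summit.Ventures.PercRepro2
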